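import Literature.Probability.Percolation.BondInterfaceFaceDomain
import Literature.Probability.RandomPlanarGeometry.CaratheodoryContinuity
import HarnessLib

/-!
# Uniform local connectedness of the complements of the polygonal face domains

Topic `Literature/Probability/Percolation` (families `crit-perc`/`crit-ising`). The input (ULC) of
Pommerenke's kernel convergence theorem (Boundary Behaviour of Conformal Maps (1992), §2.2
Prop. 2.3 / Cor. 2.4; tree: `RandomPlanarGeometry/KernelConvergenceULC.lean`,
`MarkedDomain.exists_uniformizers_of_kernel(_of_isChordalUniformizing)`) for the polygonal
Dobrushin domains `DiscreteDobrushin.faceDomain` of the square-lattice discretisations of ONE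
Jordan domain (`DiscreteFaceBoundary.lean`; the oriented versions `orientedFaceDomain` of
`BondInterfaceFaceDomain.lean`), UNIFORMLY in the mesh: for every `η > 0` there is `ε > 0` such
that, for every admissible datum of small mesh on the Jordan carrier, two boundary points of its
face domain at distance `< ε` lie in a continuum of the complement of diameter `≤ η` about the
first. This is the second conjunct of the hypothesis `PercFaceKernel` of the bond-percolation
Kemppainen–Smirnov lattice data (route `CardyComplexCone`, `…PercKSBoxFaceReduction.lean`), now
proved; the first conjunct (K1) is not treated here.

Proof (Chelkak–Duminil-Copin–Hongler–Kemppainen–Smirnov, C. R. Math. 352 (2014), §2–3, use the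
convergence `φ^δ → φ` of the uniformizing maps of these polygonal domains without comment; the
argument below is the standard one). A boundary point `a` of the face domain lies on a dart of
the boundary cycle, i.e. on a side of the NON-inner face `g` to the right of that dart
(`IsOutEdge`). (i) The closed cell of `g` misses the face domain
(`closure_cell_right_subset_compl`): its centre is joined off the boundary polygon to a point of
the exterior `(closure Ω)ᶜ` (`exists_exterior_mem_connectedComponentIn` of
`DiscreteFaceBoundary.lean`), the exterior is connected, unbounded and misses the polygon, so the
complementary component of the cell is unbounded, whereas the face domain is the bounded one.
(ii) The closed cell of `g` contains a point off `Ω` (exit witness of a non-inner face,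
`exists_witness_of_not_isInnerFace`), hence, by convexity, a point `a'` of `∂Ω` within `2δ` of `a`.
(iii) For `a, b` close, the points `a', b' ∈ ∂Ω` are close, and `ℂ ∖ Ω` is uniformly locally
connected along `∂Ω` for a Jordan domain (`JordanDomain.hlc`, Pommerenke Thm. 2.1): a small
sub-arc of the Jordan curve joins them; the face domain lies in `Ω`
(`faceDomain_carrier_subset`), so the two closed cells and the sub-arc form the required continuum.

## References

* Ch. Pommerenke, *Boundary Behaviour of Conformal Maps* (1992), §2.2 Prop. 2.3, Cor. 2.4;
  Thm. 2.1. [PommerenkeBBCM1992]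
* D. Chelkak, H. Duminil-Copin, C. Hongler, A. Kemppainen, S. Smirnov, C. R. Math. Acad. Sci.
  Paris 352 (2014) 157–161, §2–3. [CDHKSCRAS2014]
-/

noncomputable section

open Set Filter Metric
open _root_.Topology
open scoped unitInterval
open Literature.Probability.LatticeModels Literature.Probability.LatticeModels.DiscreteDobrushin
  Literature.Probability.LatticeModels.Mesh Literature.Probability.RandomPlanarGeometry
  Literature.Topology.PlaneTopology

namespace Literature.Probability.Percolation

/-! ### Cells: diameter -/

/-- Two points of a closed mesh cell are at distance `≤ 2δ`. [folklore] -/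
theorem dist_le_of_mem_closure_cell {δ : ℝ} (hδ : 0 < δ) {k j : ℤ} {z w : ℂ}
    (hz : z ∈ closure (cell δ k j)) (hw : w ∈ closure (cell δ k j)) : dist z w ≤ 2 * δ := by
  rw [closure_cell hδ] at hz hw
  obtain ⟨⟨hz1, hz2⟩, hz3, hz4⟩ := hz
  obtain ⟨⟨hw1, hw2⟩, hw3, hw4⟩ := hw
  rw [Complex.dist_eq]
  refine (Complex.norm_le_abs_re_add_abs_im _).trans ?_
  rw [Complex.sub_re, Complex.sub_im]
  have h1 : |z.re - w.re| ≤ δ := abs_sub_le_iff.2 ⟨by nlinarith, by nlinarith⟩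
  have h2 : |z.im - w.im| ≤ δ := abs_sub_le_iff.2 ⟨by nlinarith, by nlinarith⟩
  linarith

/-! ### The closed right cells of the boundary cycle miss the face domain -/

section Regular

variable {E : DiscreteDobrushin} (hE : E.IsZdAdmissible) (hΩo : IsOpen E.Ω)
  (hext : IsConnected (closure E.Ω)ᶜ) (hunb : ¬ Bornology.IsBounded (closure E.Ω)ᶜ)
  (hfr : frontier E.Ω ⊆ closure (closure E.Ω)ᶜ)

/-- The boundary polygon of the face domain lies on the scaled trace of the boundary cycle (the
converse of `strace_bcycle_subset`: both are the union of the dart segments of one period).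
[folklore] -/
theorem range_polygonLoop_bverts_subset_strace :
    range (polygonLoop (bverts hE (isOutEdge_startCorner hE))) ⊆ (bcycle hE).strace E.δ := by
  intro z hz
  rw [range_polygonLoop (List.ne_nil_of_length_pos (by rw [length_bverts]; exact bperiod_pos _ _))] at hz
  simp only [Set.mem_iUnion] at hz
  obtain ⟨k, hk⟩ := hz
  rw [getElem_bverts_succ_mod, getElem_bverts, meshPoint_eq_mul_latC, meshPoint_eq_mul_latC] at hk
  have hk' : (k : ℕ) < bperiod hE (isOutEdge_startCorner hE) :=
    lt_of_lt_of_eq k.2 (length_bverts hE _)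
  rw [(bcycle hE).mem_strace_iff]
  refine ⟨k, hk', ?_⟩
  rwa [show (bcycle hE).v k = toZ2 (E.bwalk (startCorner hE) k).1 by
      rw [bcycle, bloop_v_of_lt hk', zero_add],
    show (bcycle hE).v (k + 1) = toZ2 ((E.bwalk (startCorner hE) k).1 +
        cornerUnit (E.bwalk (startCorner hE) k).2) by
      rw [bcycle, bloop_v_succ, Nat.mod_eq_of_lt hk', zero_add]]

include hΩo hext hunb hfr in
/-- **The face domain lies in `Ω`** (not only in `closure Ω`): it is open and contained in
`closure Ω`, and a boundary point of `Ω` has exterior points arbitrarily close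
(`frontier Ω ⊆ closure (closure Ω)ᶜ`). [folklore] -/
theorem faceDomain_carrier_subset : (faceDomain hE hΩo hext hunb hfr).carrier ⊆ E.Ω := by
  intro z hz
  have hzc : z ∈ closure E.Ω := faceDomain_carrier_subset_closure hE hΩo hext hunb hfr hz
  by_contra hzΩ
  have hzf : z ∈ frontier E.Ω := by
    rw [frontier_eq_closure_inter_closure]
    exact ⟨hzc, subset_closure hzΩ⟩
  have hopen := (faceDomain hE hΩo hext hunb hfr).isOpen
  obtain ⟨x, hxU, hxE⟩ := Mesh.exists_mem_exterior_of_isOpen hΩo hfr hopen hz hzΩ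
  exact hxE (faceDomain_carrier_subset_closure hE hΩo hext hunb hfr hxU)

include hΩo hext hunb hfr in
/-- **The open cell of the non-inner face to the right of a boundary dart misses the face
domain.** Its centre is joined off the boundary polygon to a point of the exterior
`(closure Ω)ᶜ` (`exists_exterior_mem_connectedComponentIn`); the exterior is preconnected,
unbounded and misses the polygon; so the complementary component of any point of the cell is
unbounded, whereas points of the face domain have bounded complementary component. [folklore] -/
theorem cell_right_disjoint_carrier (t : ℕ) :
    Disjoint (cell E.δ ((faceAt (E.bwalk (startCorner hE) t).1 ((E.bwalk (startCorner hE) t).2 + 3)) 0)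
        ((faceAt (E.bwalk (startCorner hE) t).1 ((E.bwalk (startCorner hE) t).2 + 3)) 1))
      (faceDomain hE hΩo hext hunb hfr).carrier := by
  set h₀ := isOutEdge_startCorner hE with hh₀
  set F : Site 2 := faceAt (E.bwalk (startCorner hE) t).1 ((E.bwalk (startCorner hE) t).2 + 3) with hF
  set L := range (polygonLoop (bverts hE h₀)) with hL
  rw [Set.disjoint_left]
  intro z hz hzD
  rw [faceDomain_carrier, mem_polygonDomain_iff] at hzD
  obtain ⟨hzL, hbdd⟩ := hzD
  -- the centre of the cell is joined off the polygon to an exterior point `q`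
  obtain ⟨q, hqE, hqC⟩ := exists_exterior_mem_connectedComponentIn (i := 0)
    (m := bperiod hE h₀) (hm := bperiod_pos _ _) (hcl := by rw [zero_add, bwalk_bperiod]; rfl)
    hE.delta_pos h₀ hΩo hfr (isOutEdge_bwalk h₀ t).2 (isCorner_faceAt _ _)
    (bwalk_fst_mem_meshDomain h₀ t)
  have hsub : ((bcycle hE).strace E.δ)ᶜ ⊆ Lᶜ :=
    Set.compl_subset_compl.2 (range_polygonLoop_bverts_subset_strace hE)
  have hqC' : q ∈ connectedComponentIn Lᶜ (cellCenter E.δ (F 0) (F 1)) :=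
    connectedComponentIn_mono _ hsub hqC
  -- `z` and the centre are in the same complementary component (the cell is convex and misses `L`)
  have hdis : Disjoint (cell E.δ (F 0) (F 1)) L := disjoint_cell_range_polygonLoop_bverts hE (F 0) (F 1)
  have hzc : z ∈ connectedComponentIn Lᶜ (cellCenter E.δ (F 0) (F 1)) :=
    (convex_cell E.δ _ _).isPreconnected.subset_connectedComponentIn
      (cellCenter_mem_cell hE.delta_pos _ _) (Set.disjoint_left.1 hdis) hz
  have hKeq : connectedComponentIn Lᶜ z = connectedComponentIn Lᶜ (cellCenter E.δ (F 0) (F 1)) :=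
    (connectedComponentIn_eq hzc).symm
  -- the exterior lies in that component, and is unbounded
  have hLsub : L ⊆ closure E.Ω := by
    rw [hL, ← frontier_polygonDomain_eq_range _ (isSimpleClosedPolygon_bverts hE h₀ hΩo hext hunb hfr)]
    exact frontier_subset_closure.trans
      ((closure_mono (faceDomain_carrier_subset_closure hE hΩo hext hunb hfr)).trans
        (by rw [closure_closure]))
  have hext' : (closure E.Ω)ᶜ ⊆ connectedComponentIn Lᶜ (cellCenter E.δ (F 0) (F 1)) := by
    rw [connectedComponentIn_eq hqC']
    exact hext.isPreconnected.subset_connectedComponentIn hqE (Set.compl_subset_compl.2 hLsub)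
  apply hunb
  rw [hKeq] at hbdd
  exact hbdd.subset hext'

include hΩo hext hunb hfr in
/-- The CLOSED right cell of a boundary dart lies in the complement of the face domain.
[folklore] -/
theorem closure_cell_right_subset_compl (t : ℕ) :
    closure (cell E.δ ((faceAt (E.bwalk (startCorner hE) t).1 ((E.bwalk (startCorner hE) t).2 + 3)) 0)
        ((faceAt (E.bwalk (startCorner hE) t).1 ((E.bwalk (startCorner hE) t).2 + 3)) 1)) ⊆
      (faceDomain hE hΩo hext hunb hfr).carrierᶜ :=
  closure_minimal (Set.disjoint_left.1 (cell_right_disjoint_carrier hE hΩo hext hunb hfr t))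
    (faceDomain hE hΩo hext hunb hfr).isOpen.isClosed_compl

/-- **Exit witness in the closed right cell**: the closed cell of the non-inner face to the
right of a boundary dart contains a point off `Ω` (a point of a side leaving `closure Ω`, or a
corner that is not a mesh vertex; `exists_witness_of_not_isInnerFace`). [cite: Smirnov2001, §2] -/
theorem exists_not_mem_closure_cell_right (t : ℕ) :
    ∃ p ∈ closure (cell E.δ ((faceAt (E.bwalk (startCorner hE) t).1 ((E.bwalk (startCorner hE) t).2 + 3)) 0)
        ((faceAt (E.bwalk (startCorner hE) t).1 ((E.bwalk (startCorner hE) t).2 + 3)) 1)), p ∉ E.Ω := by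
  set h₀ := isOutEdge_startCorner hE
  set F : Site 2 := faceAt (E.bwalk (startCorner hE) t).1 ((E.bwalk (startCorner hE) t).2 + 3)
  rcases exists_witness_of_not_isInnerFace (isOutEdge_bwalk h₀ t).2 (isCorner_faceAt _ _)
      (bwalk_fst_mem_meshDomain h₀ t) with ⟨v, w, hv, hw, -, hseg⟩ | ⟨u, hu, huV⟩
  · obtain ⟨p, hp, hpΩ⟩ := Set.not_subset.1 hseg
    exact ⟨p, segment_subset_closure_cell_of_isCorner hE.delta_pos hv hw hp,
      fun h ↦ hpΩ (subset_closure h)⟩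
  · exact ⟨meshPoint E.δ u, meshPoint_mem_closure_cell_of_isCorner hE.delta_pos hu,
      fun h ↦ huV (mem_meshVertices_iff.2 h)⟩

include hΩo hext hunb hfr in
/-- **Boundary points of the face domain lie on closed right cells**: a point of the frontier
lies on a dart segment of the boundary cycle, a side of the (non-inner) face to the right of that
dart. [folklore] -/
theorem exists_mem_closure_cell_right_of_mem_frontier {a : ℂ}
    (ha : a ∈ frontier (faceDomain hE hΩo hext hunb hfr).carrier) :
    ∃ t : ℕ, a ∈ closure (cell E.δ
      ((faceAt (E.bwalk (startCorner hE) t).1 ((E.bwalk (startCorner hE) t).2 + 3)) 0)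
      ((faceAt (E.bwalk (startCorner hE) t).1 ((E.bwalk (startCorner hE) t).2 + 3)) 1)) := by
  set h₀ := isOutEdge_startCorner hE
  rw [faceDomain_carrier, frontier_polygonDomain_eq_range,
    range_polygonLoop (List.ne_nil_of_length_pos (by rw [length_bverts]; exact bperiod_pos _ _))] at ha
  simp only [Set.mem_iUnion] at ha
  obtain ⟨k, hk⟩ := ha
  rw [getElem_bverts_succ_mod, getElem_bverts] at hk
  refine ⟨k, segment_subset_closure_cell_of_isCorner hE.delta_pos (isCorner_faceAt _ _)
    ((isCorner_add_faceAt_iff _ _ _).2 (Or.inr rfl)) hk⟩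

include hΩo hext hunb hfr in
/-- **Every boundary point of the face domain lies, together with a point of `∂Ω`, in a compact
connected subset of the complement of diameter `≤ 2δ`** (the closed right cell through it: it
meets `closure Ω` at the boundary point and leaves `Ω` at the exit witness, so by convexity it
meets `∂Ω`). [folklore] -/
theorem exists_continuum_to_frontier {a : ℂ} (ha : a ∈ frontier (faceDomain hE hΩo hext hunb hfr).carrier) :
    ∃ C ⊆ (faceDomain hE hΩo hext hunb hfr).carrierᶜ, IsCompact C ∧ IsPreconnected C ∧ a ∈ C ∧
      (∃ a' ∈ C, a' ∈ frontier E.Ω) ∧ ∀ z ∈ C, ∀ w ∈ C, dist z w ≤ 2 * E.δ := by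
  obtain ⟨t, hat⟩ := exists_mem_closure_cell_right_of_mem_frontier hE hΩo hext hunb hfr ha
  set F : Site 2 := faceAt (E.bwalk (startCorner hE) t).1 ((E.bwalk (startCorner hE) t).2 + 3) with hF
  set C := closure (cell E.δ (F 0) (F 1)) with hC
  have hCc : IsCompact C := by
    rw [hC, closure_cell hE.delta_pos]
    exact (isCompact_Icc.reProdIm isCompact_Icc)
  have hCconv : Convex ℝ C := (convex_cell E.δ _ _).closure
  obtain ⟨p, hpC, hpΩ⟩ := exists_not_mem_closure_cell_right hE t
  -- `a ∈ closure Ω`, `p ∉ Ω`: the segment `[a, p] ⊆ C` meets `∂Ω`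
  have haΩ : a ∈ closure E.Ω :=
    (closure_mono (faceDomain_carrier_subset_closure hE hΩo hext hunb hfr)).trans
      (by rw [closure_closure]) (frontier_subset_closure ha)
  have hseg : segment ℝ a p ⊆ C := hCconv.segment_subset hat hpC
  obtain ⟨a', ha'seg, ha'fr⟩ : ∃ a' ∈ segment ℝ a p, a' ∈ frontier E.Ω := by
    by_cases hp : p ∈ closure E.Ω
    · exact ⟨p, right_mem_segment _ _ _, by
        rw [frontier_eq_closure_inter_closure]; exact ⟨hp, subset_closure hpΩ⟩⟩
    · -- the segment joins `closure Ω` to its complement: it meets the frontier of `closure Ω`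
      have hconn : IsPreconnected (segment ℝ a p) := (convex_segment a p).isPreconnected
      by_contra hnone
      push Not at hnone
      have hsub : segment ℝ a p ⊆ interior (closure E.Ω) ∪ (closure E.Ω)ᶜ := by
        intro x hx
        by_contra hx'
        simp only [mem_union, mem_compl_iff, not_or, not_not] at hx'
        have hxf : x ∈ frontier (closure E.Ω) := ⟨subset_closure hx'.2, hx'.1⟩
        exact hnone x hx (frontier_closure_subset hxf)
      have ha' : a ∈ interior (closure E.Ω) := by
        rcases hsub (left_mem_segment _ _ _) with h | h
        · exact h
        · exact absurd haΩ h
      have hall := hconn.subset_left_of_subset_union isOpen_interior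
        isClosed_closure.isOpen_compl (disjoint_compl_right.mono_left interior_subset) hsub
        ⟨a, left_mem_segment _ _ _, ha'⟩
      exact hp (interior_subset (hall (right_mem_segment _ _ _)))
  refine ⟨C, closure_cell_right_subset_compl hE hΩo hext hunb hfr t, hCc, hCconv.isPreconnected,
    hat, ⟨a', hseg ha'seg, ha'fr⟩, fun z hz w hw ↦ dist_le_of_mem_closure_cell hE.delta_pos hz hw⟩

end Regular

/-! ### (ULC) for the face domains of a discretisation family, uniformly in the mesh -/

variable {D : DobrushinDomain} {Λ : ℝ → DiscreteDobrushin}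

/-- **Uniform local connectedness of the complements of the face domains of a discretisation
family, uniformly over all admissible data of small mesh.** For every `η > 0` there are `ε > 0`
and `δ₀ > 0` such that for every admissible datum `Λ δ` with `δ ≤ δ₀`, two boundary points of
its face domain at distance `< ε` lie in a compact connected subset of the complement inside the
`η`-disc about the first: the two closed right cells through them (diameter `≤ 2δ`, reaching
`∂D`, `exists_continuum_to_frontier`) and a short sub-arc of the Jordan curve `∂D` between their
points of `∂D` (`JordanDomain.hlc`, Pommerenke Thm. 2.1), which misses the face domain since the
latter lies in `D` (`faceDomain_carrier_subset`). [cite: PommerenkeBBCM1992, Thm. 2.1 and Prop. 2.3] -/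
theorem hlc_familyFaceDomain (hΛ : ZdDiscretisationFamily D Λ) {η : ℝ} (hη : 0 < η) :
    ∃ ε > 0, ∃ δ₀ > 0, ∀ {δ : ℝ} (hadm : (Λ δ).IsZdAdmissible), δ ≤ δ₀ →
      ∀ a ∈ frontier (familyFaceDomain hΛ hadm).carrier,
      ∀ b ∈ frontier (familyFaceDomain hΛ hadm).carrier, dist a b < ε →
        ∃ S ⊆ (familyFaceDomain hΛ hadm).carrierᶜ, IsCompact S ∧ IsPreconnected S ∧
          a ∈ S ∧ b ∈ S ∧ S ⊆ closedBall a η := by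
  obtain ⟨ε₀, hε₀, hJ⟩ := JordanDomain.hlc D.toJordanDomain (η / 3) (by positivity)
  refine ⟨min (ε₀ / 2) (η / 3), by positivity, min (ε₀ / 8) (η / 12), by positivity, ?_⟩
  intro δ hadm hδ a ha b hb hab
  have hr := regular_of_zdDiscretisationFamily hΛ δ
  have hδE : (Λ δ).δ = δ := hΛ.δ_eq δ
  have hΩ : (Λ δ).Ω = D.carrier := hΛ.Ω_eq δ
  have hε₁ : min (ε₀ / 2) (η / 3) ≤ ε₀ / 2 := min_le_left _ _
  have hε₂ : min (ε₀ / 2) (η / 3) ≤ η / 3 := min_le_right _ _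
  have hδ₁ : δ ≤ ε₀ / 8 := hδ.trans (min_le_left _ _)
  have hδ₂ : δ ≤ η / 12 := hδ.trans (min_le_right _ _)
  -- the two closed right cells
  obtain ⟨Ca, hCaS, hCac, hCap, haCa, ⟨a', ha'Ca, ha'fr⟩, hCad⟩ :=
    exists_continuum_to_frontier hadm hr.1 hr.2.1 hr.2.2.1 hr.2.2.2 (a := a) ha
  obtain ⟨Cb, hCbS, hCbc, hCbp, hbCb, ⟨b', hb'Cb, hb'fr⟩, hCbd⟩ :=
    exists_continuum_to_frontier hadm hr.1 hr.2.1 hr.2.2.1 hr.2.2.2 (a := b) hb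
  rw [hδE] at hCad hCbd
  rw [hΩ] at ha'fr hb'fr
  -- the short sub-arc of `∂D`
  have hd1 : dist a' a ≤ 2 * δ := hCad a' ha'Ca a haCa
  have hd2 : dist b b' ≤ 2 * δ := hCbd b hbCb b' hb'Cb
  have ha'b' : dist a' b' < ε₀ := by
    calc dist a' b' ≤ dist a' a + dist a b + dist b b' := dist_triangle4 _ _ _ _
      _ < 2 * δ + min (ε₀ / 2) (η / 3) + 2 * δ := by linarith
      _ ≤ ε₀ := by linarith
  obtain ⟨τ, hτS, hτc, hτp, ha'τ, hb'τ, hτball⟩ := hJ a' ha'fr b' hb'fr ha'b'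
  have hsubD : (familyFaceDomain hΛ hadm).carrier ⊆ D.carrier := by
    rw [← hΩ]
    exact faceDomain_carrier_subset hadm hr.1 hr.2.1 hr.2.2.1 hr.2.2.2
  have hτS' : τ ⊆ (familyFaceDomain hΛ hadm).carrierᶜ :=
    hτS.trans (Set.compl_subset_compl.2 hsubD)
  -- the continuum
  refine ⟨Ca ∪ τ ∪ Cb, ?_, (hCac.union hτc).union hCbc, ?_, Or.inl (Or.inl haCa), Or.inr hbCb, ?_⟩
  · exact Set.union_subset (Set.union_subset hCaS hτS') hCbS
  · exact (IsPreconnected.union a' ha'Ca ha'τ hCap hτp).union b' (Or.inr hb'τ) hb'Cb hCbp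
  · rintro z ((hz | hz) | hz)
    · rw [mem_closedBall]
      linarith [hCad z hz a haCa]
    · rw [mem_closedBall]
      have h1 : dist z a' ≤ η / 3 := hτball hz
      calc dist z a ≤ dist z a' + dist a' a := dist_triangle _ _ _
        _ ≤ η := by linarith
    · rw [mem_closedBall]
      have h1 : dist z b ≤ 2 * δ := hCbd z hz b hbCb
      calc dist z a ≤ dist z b + dist b a := dist_triangle _ _ _
        _ ≤ η := by rw [dist_comm b a]; linarith

/-- **(ULC) for the oriented face domains along positive admissible meshes `δ_k → 0`** — the
second conjunct of the hypothesis `PercFaceKernel` of the bond-percolation Kemppainen–Smirnov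
lattice data, and the hypothesis `hlc` of
`MarkedDomain.exists_uniformizers_of_kernel(_of_isChordalUniformizing)` (Pommerenke 1992,
Cor. 2.4) for these domains: for every `η > 0` some `ε > 0` such that, for all large `k`, two
boundary points of the `k`-th oriented face domain at distance `< ε` lie in a continuum of its
complement inside the `η`-disc about the first. [cite: PommerenkeBBCM1992, Prop. 2.3 and Cor. 2.4] -/
theorem hlc_orientedFaceDomain (hΛ : ZdDiscretisationFamily D Λ) {δs : ℕ → ℝ}
    (hlim : Tendsto δs atTop (𝓝 0)) (hadm : ∀ k, (Λ (δs k)).IsZdAdmissible) :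
    ∀ η : ℝ, 0 < η → ∃ ε > 0, ∀ᶠ k in atTop,
      ∀ a ∈ frontier (orientedFaceDomain hΛ (hadm k)).carrier,
      ∀ b ∈ frontier (orientedFaceDomain hΛ (hadm k)).carrier, dist a b < ε →
        ∃ S ⊆ (orientedFaceDomain hΛ (hadm k)).carrierᶜ, IsCompact S ∧
          IsPreconnected S ∧ a ∈ S ∧ b ∈ S ∧ S ⊆ closedBall a η := by
  intro η hη
  obtain ⟨ε, hε, δ₀, hδ₀, h⟩ := hlc_familyFaceDomain hΛ hη
  refine ⟨ε, hε, ?_⟩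
  filter_upwards [hlim.eventually (Iic_mem_nhds hδ₀)] with k hk
  simpa only [carrier_orientedFaceDomain] using h (hadm k) hk

end Literature.Probability.Percolation
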